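import Summits.Ventures.LatticeQCDFlow.Scoring.AlternantPowerSumCoefficients
import Literature.RepresentationTheory.FiniteGroups.SymmetricGroupFrobeniusFormula
import Literature.RepresentationTheory.FiniteGroups.SecondOrthogonality
import Literature.RepresentationTheory.FiniteGroups.SymmetricGroupPowerSumCycles
import Mathlib.GroupTheory.Perm.Centralizer
import HarnessLib

/-!
# The squared coefficients of `a_ρ · ∏_{cycles} p_{|c|}` sum to `N! · |C_{𝔖_K}(σ)|` (`K ≤ N`)

HONEST FRAMING: exact (Metropolis-corrected) sampling algorithms for lattice gauge theory;
figures of merit are autocorrelation/cost numbers at stated couplings and volumes; no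
continuum-physics claim.

Venture `LatticeQCDFlow` (cell pub-lqcd), sub-topic `Scoring`; FANOUT row 5 (`s0-sun-a`), GEN-23.
NEW WORK of the cell (placement rule).  The algebraic half of the Diaconis–Shahshahani moment theorem
for Haar `U(N)` (P. Diaconis, M. Shahshahani, *On the eigenvalues of random matrices*, J. Appl.
Probab. 31A (1994) 49–62, Thm. 2: for `N ≥ Σ j a_j` the joint moments of `tr U, tr U², …` are those of
independent complex Gaussians `√j Z_j`), generalising `AlternantPowerSumCoefficients` (`σ = 1`,
`a_ρ p_1^n`, `Σ f_λ² = n!`) from the identity to an arbitrary permutation `σ ∈ 𝔖_K`.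

For `σ ∈ 𝔖_K` put `G_σ = a_ρ(x) · F_σ(x) ∈ ℤ[x_1, …, x_N]`, `F_σ = ∏_{cycles c of σ} p_{|c|}` the tree's
fixed-word enumerator (`fixedWordPoly`, `fixedWordPoly_eq_prod_cycleType`), so that Frobenius's
coefficient is `X^λ(σ) = [x^{λ+ρ}] G_σ` (`frobeniusChar_def`) and equals the Specht character `χ^λ(σ)`
for `ℓ(λ) ≤ N` (the tree's `spechtCharacter_eq_frobeniusChar`, Fulton–Harris Thm. 4.10).

* §1 (`G_σ` is antisymmetric: the tree's `rename_alternant_mul_fixedWordPoly`) `coeff_alternant_mul_fixedWordPoly_eq_zero`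
  (no repeated exponents), `coeff_mapDomain_mul_coeff_mapDomain` (orbit constancy of
  `[x^d]G_σ · [x^d]G_τ`), `isHomogeneous_fixedWordPoly` (degree `K`),
  `isHomogeneous_alternant_mul_fixedWordPoly` (degree `|ρ| + K`).
* §2 `sum_antitoneWeights_coeff_mul_coeff`: on the sorted representatives `λ + ρ` the products of
  coefficients are `X^λ(σ) X^λ(τ)`, `λ ⊢ K`, `ℓ(λ) ≤ N`.
* §3 **`sum_support_coeff_mul_coeff_alternant_mul_fixedWordPoly`**:
  `Σ_d [x^d]G_σ [x^d]G_τ = N! · Σ_{λ ⊢ K, ℓ(λ) ≤ N} X^λ(σ) X^λ(τ)` (all `σ, τ ∈ 𝔖_K`, all `N`).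
* §4 `sum_spechtCharacter_mul_spechtCharacter`: the second orthogonality relation of `𝔖_K` indexed
  by partitions, `Σ_{λ ⊢ K} χ^λ(σ) χ^λ(τ) = |C_{𝔖_K}(τ)| [σ ∼ τ]` (the tree's `sum_irrChars_mul_conj_eq`,
  Isaacs Thm. 2.18, with `irrChars_toFinset_perm_eq` and the reality `star_spechtCharacter`).
* §5 **`sum_support_coeff_mul_coeff_eq_centralizer`** (`K ≤ N`):
  `Σ_d [x^d]G_σ [x^d]G_τ = N! · |C_{𝔖_K}(τ)| · [σ ∼ τ]`, and the diagonal
  **`sum_support_coeff_sq_alternant_mul_fixedWordPoly`**: `Σ_d ([x^d]G_σ)² = N! · |C_{𝔖_K}(σ)|`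
  `= N! · (K − Σ cycleType)! · ∏ m · ∏ (mult m)!` (Mathlib's `Equiv.Perm.nat_card_centralizer`).
  By Parseval on the torus and Weyl's formula (`TorusParsevalPairing`) these are `N!` times the Haar
  moments `∫_{U(N)} P_σ(U) conj P_τ(U) dU`, `P_σ(U) = ∏_c tr(U^{|c|})` (sequel `UNHaarPowerSumMoments`).

No `def`, nothing cited as a fact, 0 sorry.
-/

noncomputable section

open Finset Equiv
open Literature.RingTheory.SymmetricFunctions.SymmPoly (alternant rho antitoneWeights mem_antitoneWeights
  sum_piAntidiag_eq_sum_antitoneWeights)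
open Literature.RepresentationTheory.FiniteGroups (fixedWordPoly frobeniusChar frobeniusChar_def
  rename_alternant_mul_fixedWordPoly alternant_X_eq_sum_monomial fixedWordPoly_eq_sum_monomial wordExps wordExps_apply
  coeff_eq_zero_of_antisymm_of_apply_eq coeff_mapDomain_of_rename_eq spechtCharacter_eq_frobeniusChar
  irrChars_finite_holds irrChars_toFinset_perm_eq spechtCharacter_injective star_spechtCharacter
  sum_irrChars_mul_conj_of_isConj sum_irrChars_mul_conj_of_not_isConj)
open Literature.NumberTheory.DiophantineGeometry (spechtCharacter)

namespace Summit.Ventures.LatticeQCDFlow.Scoring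

variable {N K : ℕ}

/-! ### 1. Antisymmetry, vanishing, orbit constancy, homogeneity -/

/-- `G_σ` has no monomial with a repeated exponent. -/
theorem coeff_alternant_mul_fixedWordPoly_eq_zero (σ : Perm (Fin K)) {d : Fin N →₀ ℕ}
    (hd : ¬ Function.Injective d) :
    MvPolynomial.coeff d (alternant (fun i => (MvPolynomial.X i : MvPolynomial (Fin N) ℤ)) (rho N) *
        fixedWordPoly N σ) = 0 := by
  obtain ⟨i, j, hij', hij⟩ := Function.not_injective_iff.mp hd
  exact coeff_eq_zero_of_antisymm_of_apply_eq hij (rename_alternant_mul_fixedWordPoly (rho N) σ _) hij'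

/-- Permuting an exponent vector does not change the product `[x^d]G_σ · [x^d]G_τ` (each factor picks up
the same sign). -/
theorem coeff_mapDomain_mul_coeff_mapDomain (σ τ : Perm (Fin K)) (d : Fin N →₀ ℕ) (g : Perm (Fin N)) :
    MvPolynomial.coeff (Finsupp.mapDomain g d)
        (alternant (fun i => (MvPolynomial.X i : MvPolynomial (Fin N) ℤ)) (rho N) * fixedWordPoly N σ) *
      MvPolynomial.coeff (Finsupp.mapDomain g d)
        (alternant (fun i => (MvPolynomial.X i : MvPolynomial (Fin N) ℤ)) (rho N) * fixedWordPoly N τ)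
      = MvPolynomial.coeff d
          (alternant (fun i => (MvPolynomial.X i : MvPolynomial (Fin N) ℤ)) (rho N) * fixedWordPoly N σ) *
        MvPolynomial.coeff d
          (alternant (fun i => (MvPolynomial.X i : MvPolynomial (Fin N) ℤ)) (rho N) * fixedWordPoly N τ) := by
  rw [coeff_mapDomain_of_rename_eq (rename_alternant_mul_fixedWordPoly (rho N) σ g),
    coeff_mapDomain_of_rename_eq (rename_alternant_mul_fixedWordPoly (rho N) τ g)]
  have hs : ((Equiv.Perm.sign g : ℤˣ) : ℤ) * ((Equiv.Perm.sign g : ℤˣ) : ℤ) = 1 := by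
    rw [← Units.val_mul, Int.units_mul_self, Units.val_one]
  linear_combination (MvPolynomial.coeff d
    (alternant (fun i => (MvPolynomial.X i : MvPolynomial (Fin N) ℤ)) (rho N) * fixedWordPoly N σ) *
      MvPolynomial.coeff d
    (alternant (fun i => (MvPolynomial.X i : MvPolynomial (Fin N) ℤ)) (rho N) * fixedWordPoly N τ)) * hs

/-- `a_ρ(X)` is homogeneous of degree `|ρ|`. -/
theorem isHomogeneous_alternant_X_rho :
    (alternant (fun i => (MvPolynomial.X i : MvPolynomial (Fin N) ℤ)) (rho N)).IsHomogeneous (∑ i, rho N i) := by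
  rw [alternant_X_eq_sum_monomial]
  refine MvPolynomial.IsHomogeneous.sum _ _ _ fun τ _ => ?_
  have hC : ((Equiv.Perm.sign τ : ℤ) : MvPolynomial (Fin N) ℤ) = MvPolynomial.C (Equiv.Perm.sign τ : ℤ) := by
    simp
  rw [hC, MvPolynomial.C_mul_monomial]
  refine MvPolynomial.isHomogeneous_monomial _ ?_
  rw [Finsupp.degree_eq_sum]
  simp only [Finsupp.coe_equivFunOnFinite_symm]
  exact Equiv.sum_comp τ⁻¹ (rho N)

/-- `F_σ` is homogeneous of degree `K` (each fixed word has `K` letters). -/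
theorem isHomogeneous_fixedWordPoly (σ : Perm (Fin K)) : (fixedWordPoly N σ).IsHomogeneous K := by
  rw [fixedWordPoly_eq_sum_monomial]
  refine MvPolynomial.IsHomogeneous.sum _ _ _ fun w _ => MvPolynomial.isHomogeneous_monomial _ ?_
  rw [Finsupp.degree_eq_sum]
  simp only [wordExps_apply]
  rw [← Finset.card_eq_sum_card_fiberwise fun p _ => Finset.mem_univ (w p), Finset.card_univ, Fintype.card_fin]

/-- `G_σ = a_ρ · F_σ` is homogeneous of degree `|ρ| + K`. -/
theorem isHomogeneous_alternant_mul_fixedWordPoly (σ : Perm (Fin K)) :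
    (alternant (fun i => (MvPolynomial.X i : MvPolynomial (Fin N) ℤ)) (rho N) *
        fixedWordPoly N σ).IsHomogeneous ((∑ i, rho N i) + K) :=
  isHomogeneous_alternant_X_rho.mul (isHomogeneous_fixedWordPoly σ)

/-! ### 2. Sorted representatives: Frobenius's coefficients -/

/-- On the sorted representatives `λ + ρ` (`λ ⊢ K`, `ℓ(λ) ≤ N`) the coefficient products of `G_σ, G_τ` are
`X^λ(σ) X^λ(τ)` (`frobeniusChar_def`); reindexing as in `sum_antitoneWeights_coeff_sq`. -/
theorem sum_antitoneWeights_coeff_mul_coeff (σ τ : Perm (Fin K)) :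
    ∑ la ∈ antitoneWeights N K,
        MvPolynomial.coeff (Finsupp.equivFunOnFinite.symm (la + rho N))
            (alternant (fun i => (MvPolynomial.X i : MvPolynomial (Fin N) ℤ)) (rho N) * fixedWordPoly N σ) *
          MvPolynomial.coeff (Finsupp.equivFunOnFinite.symm (la + rho N))
            (alternant (fun i => (MvPolynomial.X i : MvPolynomial (Fin N) ℤ)) (rho N) * fixedWordPoly N τ)
      = ∑ μ ∈ univ.filter (fun μ : Nat.Partition K => μ.parts.card ≤ N),
          frobeniusChar N (fun i => μ.sortedParts.getD i 0) σ * frobeniusChar N (fun i => μ.sortedParts.getD i 0) τ := by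
  symm
  refine Finset.sum_bij (fun μ _ => fun i : Fin N => μ.sortedParts.getD i 0) ?_ ?_ ?_ ?_
  · intro μ hμ
    rw [mem_filter] at hμ
    rw [mem_antitoneWeights]
    constructor
    · have h := Literature.NumberTheory.DiophantineGeometry.Weight.size_ofPartition_holds hμ.2
      change ∑ i : Fin N, ((μ.sortedParts.getD i 0 : ℕ) : ℤ) = K at h
      exact_mod_cast h
    · intro i j hij
      have h := (Literature.NumberTheory.DiophantineGeometry.Weight.isPolynomial_ofPartition_holds N μ).1 hij
      rw [Literature.NumberTheory.DiophantineGeometry.Weight.ofPartition_apply,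
        Literature.NumberTheory.DiophantineGeometry.Weight.ofPartition_apply] at h
      show μ.sortedParts.getD j 0 ≤ μ.sortedParts.getD i 0
      exact_mod_cast h
  · intro μ hμ ν hν h
    rw [mem_filter] at hμ hν
    exact Literature.NumberTheory.DiophantineGeometry.Weight.ofPartition_injOn_holds N K hμ.2 hν.2
      (funext fun i => congrArg (Nat.cast : ℕ → ℤ) (congrFun h i))
  · intro la hla
    obtain ⟨μ, hμN, hμ⟩ := exists_partition_of_mem_antitoneWeights hla
    exact ⟨μ, mem_filter.mpr ⟨mem_univ _, hμN⟩, hμ⟩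
  · intro μ _
    rw [frobeniusChar_def, frobeniusChar_def]

/-! ### 3. The coefficient pairing of `G_σ` and `G_τ` -/

/-- **`Σ_d [x^d]G_σ · [x^d]G_τ = N! · Σ_{λ ⊢ K, ℓ(λ) ≤ N} X^λ(σ) X^λ(τ)`** for all `σ, τ ∈ 𝔖_K` and all `N`:
no monomial of the antisymmetric `G_σ` has a repeated exponent, the products of coefficients are constant on
the `N!`-element orbits of the injective exponents of degree `|ρ| + K`, and on the sorted representative
`λ + ρ` they are `X^λ(σ) X^λ(τ)`. -/
theorem sum_support_coeff_mul_coeff_alternant_mul_fixedWordPoly (σ τ : Perm (Fin K)) :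
    ∑ d ∈ (alternant (fun i => (MvPolynomial.X i : MvPolynomial (Fin N) ℤ)) (rho N) * fixedWordPoly N σ).support,
        MvPolynomial.coeff d
            (alternant (fun i => (MvPolynomial.X i : MvPolynomial (Fin N) ℤ)) (rho N) * fixedWordPoly N σ) *
          MvPolynomial.coeff d
            (alternant (fun i => (MvPolynomial.X i : MvPolynomial (Fin N) ℤ)) (rho N) * fixedWordPoly N τ)
      = (N.factorial : ℤ) *
          ∑ μ ∈ univ.filter (fun μ : Nat.Partition K => μ.parts.card ≤ N),
            frobeniusChar N (fun i => μ.sortedParts.getD i 0) σ *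
              frobeniusChar N (fun i => μ.sortedParts.getD i 0) τ := by
  set G := alternant (fun i => (MvPolynomial.X i : MvPolynomial (Fin N) ℤ)) (rho N) * fixedWordPoly N σ with hG
  set H := alternant (fun i => (MvPolynomial.X i : MvPolynomial (Fin N) ℤ)) (rho N) * fixedWordPoly N τ with hH
  set F : (Fin N → ℕ) → ℤ := fun m =>
    MvPolynomial.coeff (Finsupp.equivFunOnFinite.symm m) G * MvPolynomial.coeff (Finsupp.equivFunOnFinite.symm m) H
    with hF
  -- the support sum is the sum over the antidiagonal of the degree
  have h1 : ∑ d ∈ G.support, MvPolynomial.coeff d G * MvPolynomial.coeff d H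
      = ∑ m ∈ piAntidiag univ (K + ∑ i, rho N i), F m := by
    refine Finset.sum_bij_ne_zero (fun d _ _ => ⇑d) (fun d hd _ => ?_)
      (fun d₁ _ _ d₂ _ _ h => DFunLike.coe_injective h) (fun m hm hne => ?_) (fun d _ _ => ?_)
    · rw [Finset.mem_piAntidiag]
      refine ⟨?_, fun i _ => Finset.mem_univ i⟩
      have hdeg : d.degree = (∑ i, rho N i) + K := by
        by_contra hne'
        exact (MvPolynomial.mem_support_iff.mp hd) ((isHomogeneous_alternant_mul_fixedWordPoly σ).coeff_eq_zero hne')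
      rw [← Finsupp.degree_eq_sum, hdeg, add_comm]
    · have hne' : MvPolynomial.coeff (Finsupp.equivFunOnFinite.symm m) G ≠ 0 := fun h0 => hne (by
        rw [hF]; dsimp only; rw [h0, zero_mul])
      exact ⟨Finsupp.equivFunOnFinite.symm m, MvPolynomial.mem_support_iff.mpr hne', by
        rw [hF] at hne; simpa only [Finsupp.equivFunOnFinite_symm_coe] using hne,
        Finsupp.coe_equivFunOnFinite_symm m⟩
    · rw [hF]; dsimp only
      rw [Finsupp.equivFunOnFinite_symm_coe]
  have hF0 : ∀ m : Fin N → ℕ, ¬ Function.Injective m → F m = 0 := fun m hm => by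
    rw [hF]; dsimp only
    rw [coeff_alternant_mul_fixedWordPoly_eq_zero σ (by rwa [Finsupp.coe_equivFunOnFinite_symm]), zero_mul]
  have h2 := sum_piAntidiag_eq_sum_antitoneWeights F hF0 K
  have h3 : ∀ la : Fin N → ℕ, ∀ g : Perm (Fin N), F ((la + rho N) ∘ g) = F (la + rho N) := by
    intro la g
    rw [hF]; dsimp only
    have he : Finsupp.equivFunOnFinite.symm ((la + rho N) ∘ ⇑g) =
        Finsupp.mapDomain (g.symm : Perm (Fin N)) (Finsupp.equivFunOnFinite.symm (la + rho N)) := by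
      ext a
      simp only [Finsupp.coe_equivFunOnFinite_symm, Finsupp.mapDomain_equiv_apply, Equiv.symm_symm,
        Function.comp_apply]
    rw [he, coeff_mapDomain_mul_coeff_mapDomain]
  simp_rw [h3, Finset.sum_const, Finset.card_univ, Fintype.card_perm, Fintype.card_fin] at h2
  rw [h1, h2, ← sum_antitoneWeights_coeff_mul_coeff σ τ, Finset.mul_sum]
  refine Finset.sum_congr rfl fun la _ => ?_
  rw [nsmul_eq_mul]

/-! ### 4. The second orthogonality relation of `𝔖_K`, indexed by partitions -/

/-- **`Σ_{λ ⊢ K} χ^λ(σ) χ^λ(τ) = |C_{𝔖_K}(τ)| · [σ ∼ τ]`**: the second orthogonality relation (the tree's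
`sum_irrChars_mul_conj_of_isConj` / `_of_not_isConj`, Isaacs Thm. 2.18) for the symmetric group, whose
irreducible characters are the Specht characters (`irrChars_toFinset_perm_eq`), all real (`star_spechtCharacter`). -/
theorem sum_spechtCharacter_mul_spechtCharacter (σ τ : Perm (Fin K)) :
    ∑ μ : Nat.Partition K, spechtCharacter ℂ μ σ * spechtCharacter ℂ μ τ
      = if IsConj σ τ then (Nat.card (Subgroup.centralizer ({τ} : Set (Perm (Fin K)))) : ℂ) else 0 := by
  classical
  have h' : ∑ μ : Nat.Partition K, spechtCharacter ℂ μ σ * spechtCharacter ℂ μ τ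
      = ∑ μ : Nat.Partition K, spechtCharacter ℂ μ σ * (starRingEnd ℂ) (spechtCharacter ℂ μ τ) :=
    Finset.sum_congr rfl fun μ _ => by rw [starRingEnd_apply, star_spechtCharacter]
  have key : ∑ μ : Nat.Partition K, spechtCharacter ℂ μ σ * (starRingEnd ℂ) (spechtCharacter ℂ μ τ)
      = ∑ χ ∈ (irrChars_finite_holds (Perm (Fin K))).toFinset, χ σ * (starRingEnd ℂ) (χ τ) := by
    rw [irrChars_toFinset_perm_eq, Finset.sum_image fun μ _ ν _ h => spechtCharacter_injective h]
  rw [h', key]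
  split_ifs with hc
  · exact sum_irrChars_mul_conj_of_isConj hc
  · exact sum_irrChars_mul_conj_of_not_isConj hc

/-! ### 5. `K ≤ N`: the pairing is `N!` times the centralizer order -/

/-- **`Σ_d [x^d]G_σ · [x^d]G_τ = N! · |C_{𝔖_K}(τ)| · [σ ∼ τ]` for `K ≤ N`**: every `λ ⊢ K` has at most `K ≤ N`
parts, `X^λ = χ^λ` on them (Frobenius's formula, the tree's `spechtCharacter_eq_frobeniusChar`), and the second
orthogonality relation. -/
theorem sum_support_coeff_mul_coeff_eq_centralizer (hK : K ≤ N) (σ τ : Perm (Fin K)) :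
    ((∑ d ∈ (alternant (fun i => (MvPolynomial.X i : MvPolynomial (Fin N) ℤ)) (rho N) * fixedWordPoly N σ).support,
        MvPolynomial.coeff d
            (alternant (fun i => (MvPolynomial.X i : MvPolynomial (Fin N) ℤ)) (rho N) * fixedWordPoly N σ) *
          MvPolynomial.coeff d
            (alternant (fun i => (MvPolynomial.X i : MvPolynomial (Fin N) ℤ)) (rho N) * fixedWordPoly N τ) : ℤ) : ℂ)
      = (N.factorial : ℂ) *
          (if IsConj σ τ then (Nat.card (Subgroup.centralizer ({τ} : Set (Perm (Fin K)))) : ℂ) else 0) := by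
  have hparts : ∀ μ : Nat.Partition K, μ.parts.card ≤ N := fun μ => by
    have hμ := Multiset.card_nsmul_le_sum (s := μ.parts) (a := 1) fun x hx => μ.parts_pos hx
    rw [smul_eq_mul, mul_one, μ.parts_sum] at hμ
    exact hμ.trans hK
  rw [sum_support_coeff_mul_coeff_alternant_mul_fixedWordPoly, ← sum_spechtCharacter_mul_spechtCharacter,
    Finset.filter_true_of_mem fun μ _ => hparts μ]
  push_cast
  refine congrArg _ (Finset.sum_congr rfl fun μ _ => ?_)
  rw [spechtCharacter_eq_frobeniusChar μ (hparts μ) σ, spechtCharacter_eq_frobeniusChar μ (hparts μ) τ]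

/-- **`Σ_d ([x^d]G_σ)² = N! · |C_{𝔖_K}(σ)|` for `K ≤ N`** (integer form of the diagonal). -/
theorem sum_support_coeff_sq_alternant_mul_fixedWordPoly (hK : K ≤ N) (σ : Perm (Fin K)) :
    ∑ d ∈ (alternant (fun i => (MvPolynomial.X i : MvPolynomial (Fin N) ℤ)) (rho N) * fixedWordPoly N σ).support,
        MvPolynomial.coeff d
            (alternant (fun i => (MvPolynomial.X i : MvPolynomial (Fin N) ℤ)) (rho N) * fixedWordPoly N σ) ^ 2
      = (N.factorial : ℤ) * Nat.card (Subgroup.centralizer ({σ} : Set (Perm (Fin K)))) := by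
  have h := sum_support_coeff_mul_coeff_eq_centralizer hK σ σ
  rw [if_pos (IsConj.refl σ)] at h
  simp_rw [sq]
  exact_mod_cast h

/-- The same with the centralizer order made explicit (Mathlib's `Equiv.Perm.nat_card_centralizer`):
**`Σ_d ([x^d]G_σ)² = N! · (K − Σ cycleType σ)! · ∏ cycleType σ · ∏_m (mult_σ m)!`**, i.e. `N! · ∏_j j^{a_j} a_j!`
for a permutation with `a_j` cycles of length `j` (fixed points included). -/
theorem sum_support_coeff_sq_alternant_mul_fixedWordPoly_eq (hK : K ≤ N) (σ : Perm (Fin K)) :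
    ∑ d ∈ (alternant (fun i => (MvPolynomial.X i : MvPolynomial (Fin N) ℤ)) (rho N) * fixedWordPoly N σ).support,
        MvPolynomial.coeff d
            (alternant (fun i => (MvPolynomial.X i : MvPolynomial (Fin N) ℤ)) (rho N) * fixedWordPoly N σ) ^ 2
      = (N.factorial : ℤ) * ((K - σ.cycleType.sum).factorial * σ.cycleType.prod *
          ∏ m ∈ σ.cycleType.toFinset, (σ.cycleType.count m).factorial : ℕ) := by
  rw [sum_support_coeff_sq_alternant_mul_fixedWordPoly hK, Equiv.Perm.nat_card_centralizer, Fintype.card_fin]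

/-- **Orthogonality for non-conjugate `σ, τ ∈ 𝔖_K`, `K ≤ N`: `Σ_d [x^d]G_σ · [x^d]G_τ = 0`.** -/
theorem sum_support_coeff_mul_coeff_eq_zero (hK : K ≤ N) {σ τ : Perm (Fin K)} (h : ¬ IsConj σ τ) :
    ∑ d ∈ (alternant (fun i => (MvPolynomial.X i : MvPolynomial (Fin N) ℤ)) (rho N) * fixedWordPoly N σ).support,
        MvPolynomial.coeff d
            (alternant (fun i => (MvPolynomial.X i : MvPolynomial (Fin N) ℤ)) (rho N) * fixedWordPoly N σ) *
          MvPolynomial.coeff d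
            (alternant (fun i => (MvPolynomial.X i : MvPolynomial (Fin N) ℤ)) (rho N) * fixedWordPoly N τ) = 0 := by
  have h' := sum_support_coeff_mul_coeff_eq_centralizer hK σ τ
  rw [if_neg h, mul_zero] at h'
  exact_mod_cast h'

end Summit.Ventures.LatticeQCDFlow.Scoring
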